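import Mathlib
import Summits.Ventures.PercRepro2.TypedSeries

/-!
# The two-terminal transfer (blind cell PercRepro2, p2 g3, 2026-08-25; mine-1 §26(e), the lead's
ruling INBOX 3863 (2)) — graph and state level

A typed subgraph `H` attached to the rest of the graph at exactly two TERMINALS `s ≠ t`: its edges
`L` have both ends in `I ∪ {s, t}` (`I` = the INTERNAL vertices, unmarked), and every other edge at
an internal vertex is closed. Then, among the vertices off `I`, the connections of `ω` are those of
the configuration in which `L` is closed and ONE edge `h₀ ∈ L`, re-attached to `s(s, t)`, is open
exactly when `s` and `t` are joined through the open edges of `L` (`conn_twoTerminal`). Hence the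
7-coordinate state of the crux kernel (`st`, the five marks off `I`) is the same for both
(`st_twoTerminal`) — the graph content of the two-terminal lemma; the counting identity is
`TypedTwoTerminal.lean`. Subsumes the series (`conn_series`: `I = {w}`) and parallel rules.
-/

namespace Summit.Ventures.PercRepro2

namespace CovForm

namespace TypedRed

namespace TwoTerm

section Parts

variable {E : Type*} [DecidableEq E]

/-- The part of `ω` on `L` (closed off `L`). -/
def onL (L : Finset E) (ω : Config E) : Config E := fun e => if e ∈ L then ω e else false

/-- The part of `ω` off `L` (closed on `L`). -/
def offL (L : Finset E) (ω : Config E) : Config E := fun e => if e ∈ L then false else ω e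

/-- `L` taken from `a`, the rest from `x`. -/
def patchL (L : Finset E) (a x : Config E) : Config E := fun e => if e ∈ L then a e else x e

/-- On `L`, `onL` is `ω`. -/
lemma onL_of_mem {L : Finset E} {ω : Config E} {e : E} (h : e ∈ L) : onL L ω e = ω e := by
  simp [onL, h]

/-- Off `L`, `onL` is closed. -/
lemma onL_of_not_mem {L : Finset E} {ω : Config E} {e : E} (h : e ∉ L) : onL L ω e = false := by
  simp [onL, h]

/-- On `L`, `offL` is closed. -/
lemma offL_of_mem {L : Finset E} {ω : Config E} {e : E} (h : e ∈ L) : offL L ω e = false := by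
  simp [offL, h]

/-- Off `L`, `offL` is `ω`. -/
lemma offL_of_not_mem {L : Finset E} {ω : Config E} {e : E} (h : e ∉ L) : offL L ω e = ω e := by
  simp [offL, h]

/-- `onL L ω ≤ ω`. -/
lemma onL_le (L : Finset E) (ω : Config E) : onL L ω ≤ ω := by
  intro e
  by_cases h : e ∈ L
  · rw [onL_of_mem h]
  · rw [onL_of_not_mem h]; exact Bool.false_le _

/-- `offL L ω ≤ ω`. -/
lemma offL_le (L : Finset E) (ω : Config E) : offL L ω ≤ ω := by
  intro e
  by_cases h : e ∈ L
  · rw [offL_of_mem h]; exact Bool.false_le _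
  · rw [offL_of_not_mem h]

/-- On `L`, the patch is `a`. -/
lemma patchL_of_mem {L : Finset E} {a x : Config E} {e : E} (h : e ∈ L) : patchL L a x e = a e := by
  simp [patchL, h]

/-- Off `L`, the patch is `x`. -/
lemma patchL_of_not_mem {L : Finset E} {a x : Config E} {e : E} (h : e ∉ L) :
    patchL L a x e = x e := by
  simp [patchL, h]

/-- `ω` is its own patch. -/
lemma patchL_onL_offL (L : Finset E) (ω : Config E) : patchL L (onL L ω) (offL L ω) = ω := by
  funext e
  by_cases h : e ∈ L
  · rw [patchL_of_mem h, onL_of_mem h]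
  · rw [patchL_of_not_mem h, offL_of_not_mem h]

/-- The `L`-part of a patch is `a` when `a` is supported on `L`. -/
lemma onL_patchL {L : Finset E} {a : Config E} (ha : ∀ e, e ∉ L → a e = false) (x : Config E) :
    onL L (patchL L a x) = a := by
  funext e
  by_cases h : e ∈ L
  · rw [onL_of_mem h, patchL_of_mem h]
  · rw [onL_of_not_mem h, ha e h]

/-- The part off `L` of a patch is `x` when `x` is closed on `L`. -/
lemma offL_patchL {L : Finset E} (a : Config E) {x : Config E} (hx : ∀ e ∈ L, x e = false) :
    offL L (patchL L a x) = x := by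
  funext e
  by_cases h : e ∈ L
  · rw [offL_of_mem h, hx e h]
  · rw [offL_of_not_mem h, patchL_of_not_mem h]

end Parts

/-! ## The transfer at configuration level -/

section Conn

variable {V : Type*} {E : Type*} [DecidableEq E]

/-- **The two-terminal transfer.** `H` = the edges `L`, both ends in `I ∪ {s, t}`; every edge at a
vertex of `I` off `L` closed in `ω`; `j` says whether `s, t` are joined through the open edges of
`L`. Then, for `p, q ∉ I`: `p ↔ q` in `ω` iff `p ↔ q` in `ω` with `L` closed and `h₀ ∈ L`, re-attached
to `s(s, t)`, open iff `j`. -/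
theorem conn_twoTerminal {ends : E → Sym2 V} {I : Set V} {s t : V} (hs : s ∉ I) (ht : t ∉ I)
    {L : Finset E} (hLI : ∀ e ∈ L, ∀ v ∈ ends e, v ∈ I ∨ v = s ∨ v = t)
    {h₀ : E} (h₀L : h₀ ∈ L) (ω : Config E)
    (hcl : ∀ e, e ∉ L → (∃ v ∈ I, v ∈ ends e) → ω e = false)
    {j : Bool} (hj : j = true ↔ Conn ends (onL L ω) s t)
    {p q : V} (hp : p ∉ I) (hq : q ∉ I) :
    Conn ends ω p q ↔
      Conn (Function.update ends h₀ s(s, t)) (Function.update (offL L ω) h₀ j) p q := by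
  set ends' := Function.update ends h₀ s(s, t) with hends'
  set ω' := Function.update (offL L ω) h₀ j with hω'
  -- the virtual edge
  have hvirt : Conn ends (onL L ω) s t → Conn ends' ω' s t := fun hc => by
    refine conn_of_openAdj ⟨h₀, ?_, ?_⟩
    · rw [hω', Function.update_self]; exact hj.2 hc
    · rw [hends', Function.update_self]
  -- a vertex of an edge of `L` off `I` is a terminal
  have hterm : ∀ e ∈ L, ∀ v ∈ ends e, v ∉ I → v = s ∨ v = t := fun e he v hv hvI => by
    rcases hLI e he v hv with h | h | h
    · exact absurd h hvI
    · exact Or.inl h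
    · exact Or.inr h
  -- two distinct terminals joined in the `L`-part give the virtual edge
  have hpair : ∀ x y : V, (x = s ∨ x = t) → (y = s ∨ y = t) → x ≠ y →
      Conn ends (onL L ω) x y → Conn ends' ω' x y := fun x y hx hy hxy hc => by
    rcases hx with rfl | rfl <;> rcases hy with rfl | rfl
    · exact absurd rfl hxy
    · exact hvirt hc
    · exact conn_symm (hvirt (conn_symm hc))
    · exact absurd rfl hxy
  constructor
  · intro hpq
    -- closure lemma on the invariant
    let S : Set V := {v | (v ∉ I ∧ Conn ends' ω' p v) ∨
      (v ∈ I ∧ ∃ r, (r = s ∨ r = t) ∧ Conn ends' ω' p r ∧ Conn ends (onL L ω) r v)}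
    have hpS : p ∈ S := Or.inl ⟨hp, conn_refl _ _ _⟩
    have hclosed : ∀ x ∈ S, ∀ y, (openGraph ends ω).Adj x y → y ∈ S := by
      intro x hx y hxy
      rw [openGraph_adj] at hxy
      obtain ⟨hne, e, he, hends⟩ := hxy
      have hxe : x ∈ ends e := by rw [hends]; exact Sym2.mem_mk_left x y
      have hye : y ∈ ends e := by rw [hends]; exact Sym2.mem_mk_right x y
      by_cases heL : e ∈ L
      · -- an edge of `H`: open in the `L`-part
        have hconnL : Conn ends (onL L ω) x y :=
          conn_of_openAdj ⟨e, by rw [onL_of_mem heL]; exact he, hends⟩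
        rcases hx with ⟨hxI, hpx⟩ | ⟨hxI, r, hr, hpr, hrx⟩
        · -- `x` external, hence a terminal
          have hxt := hterm e heL x hxe hxI
          by_cases hyI : y ∈ I
          · exact Or.inr ⟨hyI, x, hxt, hpx, hconnL⟩
          · have hyt := hterm e heL y hye hyI
            exact Or.inl ⟨hyI, conn_trans hpx (hpair x y hxt hyt hne hconnL)⟩
        · -- `x` internal, reached from the terminal `r` inside `H`
          have hry : Conn ends (onL L ω) r y := conn_trans hrx hconnL
          by_cases hyI : y ∈ I
          · exact Or.inr ⟨hyI, r, hr, hpr, hry⟩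
          · have hyt := hterm e heL y hye hyI
            by_cases hry' : r = y
            · subst hry'; exact Or.inl ⟨hyI, hpr⟩
            · exact Or.inl ⟨hyI, conn_trans hpr (hpair r y hr hyt hry' hry)⟩
      · -- an edge off `H`: no internal end, same edge in `ω'`
        have hxI : x ∉ I := fun hxI => by
          have := hcl e heL ⟨x, hxI, hxe⟩; rw [he] at this; exact Bool.noConfusion this
        have hyI : y ∉ I := fun hyI => by
          have := hcl e heL ⟨y, hyI, hye⟩; rw [he] at this; exact Bool.noConfusion this
        have heh : e ≠ h₀ := fun h => heL (h ▸ h₀L)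
        have hadj : OpenAdj ends' ω' x y := ⟨e, by
            rw [hω', Function.update_of_ne heh, offL_of_not_mem heL]; exact he,
          by rw [hends', Function.update_of_ne heh]; exact hends⟩
        rcases hx with ⟨_, hpx⟩ | ⟨hxI', _⟩
        · exact Or.inl ⟨hyI, conn_trans hpx (conn_of_openAdj hadj)⟩
        · exact absurd hxI' hxI
    have hqS : q ∈ S := mem_of_conn_of_closed hclosed hpS hpq
    rcases hqS with ⟨_, h⟩ | ⟨hqI, _⟩
    · exact h
    · exact absurd hqI hq
  · intro hpq
    let S : Set V := {v | Conn ends ω p v}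
    have hpS : p ∈ S := conn_refl _ _ _
    have hclosed : ∀ x ∈ S, ∀ y, (openGraph ends' ω').Adj x y → y ∈ S := by
      intro x hx y hxy
      rw [openGraph_adj] at hxy
      obtain ⟨hne, e, he, hends⟩ := hxy
      by_cases heh : e = h₀
      · -- the virtual edge: `s, t` joined in the `L`-part, hence in `ω`
        subst heh
        rw [hω', Function.update_self] at he
        rw [hends', Function.update_self] at hends
        have hst : Conn ends ω s t := conn_mono (onL_le L ω) (hj.1 he)
        have hxy : Conn ends ω x y := by
          rcases Sym2.eq_iff.1 hends with ⟨rfl, rfl⟩ | ⟨rfl, rfl⟩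
          · exact hst
          · exact conn_symm hst
        exact conn_trans hx hxy
      · rw [hω', Function.update_of_ne heh] at he
        rw [hends', Function.update_of_ne heh] at hends
        have heL : e ∉ L := fun heL => by
          rw [offL_of_mem heL] at he; exact Bool.noConfusion he
        rw [offL_of_not_mem heL] at he
        exact conn_trans hx (conn_of_openAdj ⟨e, he, hends⟩)
    exact mem_of_conn_of_closed hclosed hpS hpq

end Conn

/-! ## The state -/

section State

open OneTyped

variable {V : Type*} {E : Type*} [DecidableEq E]

/-- The 7-coordinate state of the crux kernel is the same before and after the two-terminal
transfer, the five marks lying off `I`. -/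
lemma st_twoTerminal (ends : E → Sym2 V) (o a₁ a₂ a₃ b : V) {I : Set V} {s t : V} (hs : s ∉ I)
    (ht : t ∉ I) (hI : ∀ v ∈ I, v ≠ o ∧ v ≠ a₁ ∧ v ≠ a₂ ∧ v ≠ a₃ ∧ v ≠ b)
    {L : Finset E} (hLI : ∀ e ∈ L, ∀ v ∈ ends e, v ∈ I ∨ v = s ∨ v = t)
    {h₀ : E} (h₀L : h₀ ∈ L) (ω : Config E)
    (hcl : ∀ e, e ∉ L → (∃ v ∈ I, v ∈ ends e) → ω e = false)
    {j : Bool} (hj : j = true ↔ Conn ends (onL L ω) s t) :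
    st ends o a₁ a₂ a₃ b ω =
      st (Function.update ends h₀ s(s, t)) o a₁ a₂ a₃ b (Function.update (offL L ω) h₀ j) := by
  have ho : o ∉ I := fun h => (hI o h).1 rfl
  have h1 : a₁ ∉ I := fun h => (hI a₁ h).2.1 rfl
  have h2 : a₂ ∉ I := fun h => (hI a₂ h).2.2.1 rfl
  have h3 : a₃ ∉ I := fun h => (hI a₃ h).2.2.2.1 rfl
  have hb : b ∉ I := fun h => (hI b h).2.2.2.2 rfl
  have key := fun {p q : V} (hp : p ∉ I) (hq : q ∉ I) =>
    conn_twoTerminal hs ht hLI h₀L ω hcl hj hp hq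
  unfold st
  simp only [Prod.mk.injEq]
  exact ⟨decide_eq_decide.mpr (key h2 h1), decide_eq_decide.mpr (key h1 ho),
    decide_eq_decide.mpr (key h2 ho), decide_eq_decide.mpr (key h1 hb),
    decide_eq_decide.mpr (key h2 hb), decide_eq_decide.mpr (key h1 h3),
    decide_eq_decide.mpr (key h2 h3)⟩

end State

end TwoTerm

end TypedRed

end CovForm

end Summit.Ventures.PercRepro2
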